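import Summits.BirchSwinnertonDyer.BirchSwinnertonDyer.Theorems.RamifiedHeegnerPairTwistUnitInertZero
import HarnessLib

/-!
# U₀ at the two-SPLIT-carrier Gss2 classes (rank zero; the Shimura rows), TU₀|inert — part B: `39627j1`, `95571h1`

Continuation of `…Theorems.RamifiedHeegnerPairTwistUnitInertZero` (seat `bsd-trib-w-rhp` g14; the two rank-zero doors
`leafRankZeroUpper_three_of_twoCarriers_of_sqrtField` / `leafRankZeroUpper_three_of_twoInert_twoOutside_of_sqrtField` and the full framing are there; the generic
kernel lemmas are in `…TwistUnitInert`): per rank-zero curve `subGss_three_<label>` (Addv ∧ SubGss at `3` in the kernel), `Δ_eq_/c₄_eq_/krausList_<label>`, Kraus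
minimality of `V = E^{(-3)}_min` and of the twist model `Wd`, and `u0_at_<label> : … → MissingUpperBoundAt W 3` by rhp-p2 g10's certificate shape p662479
`LeafShimuraInert.leafRankZeroUpper_three_of_shimuraInertDatum_of_twistUnitZero` with the six printed facts `hGZK hmod hnf hJL hCO hHK` as hypotheses, the split / no-split / Tate
certificates, `hothers`, `hshape` and the field congruences IN THE KERNEL, and `hN hr Dt hc` + `L(E^D,1) = 0 ≠ L′(E^D,1)` + `#Ш(Wd)_an` DISPLAYED (census kit j318499:
rank-one-twist certificates `X = L′·T²/(Ω·∏c·ĥ)` at a saturated point).  **HONEST FRAMING: theorems only; nothing is booked, no item is closed; U₀ (26024) /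
TU₀|inert / the Shimura-curve Gross–Zagier–Kolyvagin inputs stay research-level and OPEN class-wide; BSD is NOT proved for any curve by this file.**
[cite: JetchevSkinnerWan2017, §7.4.2 (p. 31), Thm. 4.4.1 (p. 19)] [cite: PastenShimura2024, Prop. 6.13, Lemma 6.16, Lemma 6.18 (pp. 23–24)]
[cite: PapikianRabinoff2016, Cor. 3.5] [cite: SilvermanAEC2009, VII.5 Prop. 5.1] [cite: SilvermanATAEC1994, IV.9.4] [cite: Tate1975, §7] [cite: Kraus1989, Prop. 1]
[cite: Marcus2018, Ch. 3 Thm. 25] [cite: Miller2011LMS, Def. 1.1] [cite: Cremona2006, Table 1]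
-/

set_option linter.dupNamespace false
set_option autoImplicit false

noncomputable section

open scoped Classical NumberField

open WeierstrassCurve NumberField IsDedekindDomain IsDedekindDomain.HeightOneSpectrum Rat.HeightOneSpectrum Field Literature Literature.NumberTheory.DiophantineGeometry
  Literature.NumberTheory.EllipticCurves Literature.NumberTheory.EllipticCurves.ModularForms Literature.NumberTheory.EllipticCurves.Rank1Residual
  Literature.NumberTheory.EllipticCurves.Rank1Residual.Typed Literature.NumberTheory.Automorphic Literature.NumberTheory.EllipticCurves.Rank1Residual.X11RankOneCertificates
  Literature.NumberTheory.EllipticCurves.KrizLi2019 Literature.NumberTheory.GaloisRepresentations Literature.NumberTheory.QuadraticFields Literature.NumberTheory.QuadraticFields.Quadratic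
  Summit.BirchSwinnertonDyer.BirchSwinnertonDyer.Rank1Residual Summit.BirchSwinnertonDyer.BirchSwinnertonDyer.Rank1Residual.IntModel
  Summit.BirchSwinnertonDyer.BirchSwinnertonDyer.Rank2Observatory.Tam Summit.BirchSwinnertonDyer.Rank1Residual Summit.BirchSwinnertonDyer.Rank1Residual.Additive
  Summit.BirchSwinnertonDyer.Rank1Residual.X11b Summit.BirchSwinnertonDyer.Rank1Residual.X11b.Three Summit.BirchSwinnertonDyer.Rank1Residual.X9 Summit.BirchSwinnertonDyer.Rank1Residual.GaloisImage
  Summit.BirchSwinnertonDyer.Rank1Residual.Supersingular Summit.BirchSwinnertonDyer.BirchSwinnertonDyer.Theses.RamifiedHeegnerPair Summit.BirchSwinnertonDyer.BirchSwinnertonDyer.Theorems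
  Summit.BirchSwinnertonDyer.BirchSwinnertonDyer.Theorems.SchneiderFree Summit.BirchSwinnertonDyer.BirchSwinnertonDyer.Theorems.RamifiedPairUpperBound
  Summit.BirchSwinnertonDyer.BirchSwinnertonDyer.Theorems.RamifiedHeegnerPairStepLIntrinsic Summit.BirchSwinnertonDyer.BirchSwinnertonDyer.Theorems.AdditiveBranchIMCGordTwoRankOne.HeegnerKolyvagin
  Summit.BirchSwinnertonDyer.BirchSwinnertonDyer.Theorems.RamifiedHeegnerPairTwistUnitIntrinsic Summit.BirchSwinnertonDyer.BirchSwinnertonDyer.Theorems.RamifiedHeegnerPairTwistUnitAdditive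

namespace Summit.BirchSwinnertonDyer.BirchSwinnertonDyer.Theorems.RamifiedHeegnerPairTwistUnitInertZero

open RamifiedHeegnerPairTwistUnitInert

/-! ## §1 `39627j1` = `[0, 0, 1, -1311777, -777409819]`, `N = 39627 = 3^2·7·17·37` (`3`: I₀*, `c = 1`, `7`: I3, `c = 3`, split, `17`: I3, `c = 3`, split, `37`: I7, `c = 1`, non-split); carriers `S = {7, 17}` (split, `3 ∣ ord Δ`), (DEG) by Papikian–Rabinoff at `q₂ = 17` (odd, `≡ 2 (mod 3)`);
`r_an = 0`, `#E(ℚ)_tors = 1`, `∏ c_ℓ = 9`, `#Ш(E)_an = 1` (Cremona/LMFDB, displayed where used); class `39627j` of size 1.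
`V = E^{(-3)}_min = [0, 0, 1, -145753, 28792956]` (`#Ṽ(𝔽₃) = 7`).  JSW field `K = ℚ(√-11)` (`11` prime; `7`, `17` inert, every other `ℓ ∣ N` split): the least such `D` (among those tried) with a CERTIFIED twist unit
(kit j318499: root no. `−1`, `L′(Wd,1) = 0.757141`, `Wd = E^{(-11)}_min = [0, 0, 1, -158725017, 1034732468756]`, `N(Wd) = 4794867`, `∏c = 2`, `T = 1`, point by `ellrank(effort=0)`, eclib-full saturation (index 1), `ĥ = 7.197945`,
`X = L′T²/(Ω∏c ĥ) = 1` to `1e-16` — the numerical `#Ш(Wd)_an` given rank `1`). -/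

/-- `V = [0, 0, 1, -145753, 28792956]` (the minimal model of `39627j1^{(-3)}`, conductor `4403`): `Δ ≠ 0` in the kernel. [cite: Cremona2006, Table 1 (Cremona label 39627j1)] -/
theorem isElliptic_sV39627j1 : (⟨0, 0, 1, -145753, 28792956⟩ : WeierstrassCurve ℚ).IsElliptic :=
  isElliptic_of_discOf_ne_zero 0 0 1 (-145753) 28792956 (by decide +kernel)

/-- `V` is globally minimal: `|Δ| = 7^3·17^3·37^7` kernel-checked, Kraus' criterion prime by prime. [cite: Kraus1989, Prop. 1 and Prop. 2]
[cite: SilvermanAEC2009, VII.1 Remark 1.1] [cite: Cremona2006, Table 1 (Cremona label 39627j1)] -/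
theorem isGloballyMinimal_sV39627j1 : (⟨0, 0, 1, -145753, 28792956⟩ : WeierstrassCurve ℚ).IsGloballyMinimal :=
  isGloballyMinimal_of_krausCriterion₃_factored 0 0 1 (-145753) 28792956
    [(7, 3), (17, 3), (37, 7)] (by decide +kernel)
    (by intro qe hqe; simp only [List.mem_cons, List.not_mem_nil, or_false] at hqe
        rcases hqe with rfl | rfl | rfl <;> norm_num)
    (by set_option synthInstance.maxSize 2000 in decide +kernel)

/-- `Wd = [0, 0, 1, -158725017, 1034732468756]` (the minimal model of the twist `39627j1^{(-11)}`, conductor `4794867`): `Δ ≠ 0` in the kernel. [cite: Cremona2006, Table 1 (Cremona label 39627j1)] -/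
theorem isElliptic_sWd39627j1 : (⟨0, 0, 1, -158725017, 1034732468756⟩ : WeierstrassCurve ℚ).IsElliptic :=
  isElliptic_of_discOf_ne_zero 0 0 1 (-158725017) 1034732468756 (by decide +kernel)

/-- `Wd` is globally minimal: `|Δ| = 3^6·7^3·11^6·17^3·37^7` kernel-checked, Kraus' criterion prime by prime. [cite: Kraus1989, Prop. 1 and Prop. 2]
[cite: SilvermanAEC2009, VII.1 Remark 1.1] [cite: Cremona2006, Table 1 (Cremona label 39627j1)] -/
theorem isGloballyMinimal_sWd39627j1 : (⟨0, 0, 1, -158725017, 1034732468756⟩ : WeierstrassCurve ℚ).IsGloballyMinimal :=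
  isGloballyMinimal_of_krausCriterion₃_factored 0 0 1 (-158725017) 1034732468756
    [(3, 6), (7, 3), (11, 6), (17, 3), (37, 7)] (by decide +kernel)
    (by intro qe hqe; simp only [List.mem_cons, List.not_mem_nil, or_false] at hqe
        rcases hqe with rfl | rfl | rfl | rfl | rfl <;> norm_num)
    (by set_option synthInstance.maxSize 2000 in decide +kernel)

/-- **`39627j1` is ADDITIVE at `3` and on the cell (G) ∧ ss, IN THE KERNEL**: `3 ∣ Δ`, `3 ∣ c₄`; `C • V^{(-3)} = E` (`[u, r, s, t] = [1, 0, 0, 1/2]`) with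
`V` globally minimal, `3 ∤ Δ(V)`, `#Ṽ(𝔽₃) = 7` (`a₃(V) = -3`, supersingular), whence `TypeG`, `SubGord`, `SubGss` at `3` (g13's block, unchanged).
[cite: SilvermanAEC2009, VII.5 Prop. 5.1 (a), (c)] [cite: Delbourgo1998, §1.5 (G)] [cite: Cremona2006, Table 1 (Cremona label 39627j1)] -/
theorem subGss_three_39627j1 {W : WeierstrassCurve ℚ} [W.IsElliptic] [W.IsGloballyMinimal] (hWeq : W = (⟨0, 0, 1, -1311777, -777409819⟩ : WeierstrassCurve ℚ)) :
    Addv W 3 ∧ SubGss W 3 := by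
  subst hWeq
  haveI := isElliptic_sV39627j1
  haveI := isGloballyMinimal_sV39627j1
  have hIW : integralModelInt (⟨0, 0, 1, -1311777, -777409819⟩ : WeierstrassCurve ℚ) = (⟨0, 0, 1, -1311777, -777409819⟩ : WeierstrassCurve ℤ) :=
    integralModelInt_eq_of_map_eq _ (map_mk_int 0 0 1 (-1311777) (-777409819))
  have hadd : Addv (⟨0, 0, 1, -1311777, -777409819⟩ : WeierstrassCurve ℚ) 3 := Additive.addv_of_intModel hIW 3 (by decide +kernel) (by decide +kernel)
  have hIV : integralModelInt (⟨0, 0, 1, -145753, 28792956⟩ : WeierstrassCurve ℚ) = (⟨0, 0, 1, -145753, 28792956⟩ : WeierstrassCurve ℤ) :=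
    integralModelInt_eq_of_map_eq _ (map_mk_int 0 0 1 (-145753) 28792956)
  have hcV : Nat.card ((((⟨0, 0, 1, -145753, 28792956⟩ : WeierstrassCurve ℤ)).map (Int.castRingHom (ZMod 3))).toAffine.Point) = 7 := by
    have h := natCard_point_eq_countPoints 0 0 1 (-145753) 28792956 3 (by norm_num) (by decide +kernel)
    have h' : countPoints [0, 0, 1, -145753, 28792956] 3 = 7 := countPoints_eq_of_fast (by decide +kernel)
    exact_mod_cast h.trans h'
  have hgood : GoodSS (⟨0, 0, 1, -145753, 28792956⟩ : WeierstrassCurve ℚ) 3 := Supersingular.goodSS_of_intModel 3 hIV (by decide +kernel) hcV (by decide)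
  have hVW : (⟨1, (0 : ℚ), (0 : ℚ), ((1:ℚ)/2)⟩ : VariableChange ℚ) • (⟨0, 0, 1, -145753, 28792956⟩ : WeierstrassCurve ℚ).quadraticTwist (-3) =
      (⟨0, 0, 1, -1311777, -777409819⟩ : WeierstrassCurve ℚ) := by
    ext <;> simp [WeierstrassCurve.variableChange_a₁, WeierstrassCurve.variableChange_a₂,
      WeierstrassCurve.variableChange_a₃, WeierstrassCurve.variableChange_a₄, WeierstrassCurve.variableChange_a₆,
      WeierstrassCurve.quadraticTwist, WeierstrassCurve.b₂, WeierstrassCurve.b₄, WeierstrassCurve.b₆] <;> norm_num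
  obtain ⟨C, hC⟩ := exists_variableChange_quadraticTwist_symm (⟨0, 0, 1, -1311777, -777409819⟩ : WeierstrassCurve ℚ)
    (⟨0, 0, 1, -145753, 28792956⟩ : WeierstrassCurve ℚ) (d := (-3 : ℚ)) (by norm_num) ⟨_, hVW⟩
  have hC' : C • (⟨0, 0, 1, -1311777, -777409819⟩ : WeierstrassCurve ℚ).quadraticTwist ((-1 : ℚ) ^ ((3 : ℕ) / 2) * (3 : ℕ)) =
      (⟨0, 0, 1, -145753, 28792956⟩ : WeierstrassCurve ℚ) := by
    rw [O5.pstar_three]; exact hC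
  have hG : TypeG (⟨0, 0, 1, -1311777, -777409819⟩ : WeierstrassCurve ℚ) 3 := (typeG_three_iff_good_twist _ hadd _ C hC').mpr hgood.1
  exact ⟨hadd, (O5.subGss_three_iff_subGord_and_goodSS_twist _ hadd _ C hC).mpr
    ⟨subGord_three_of_typeG_of_addv _ hG hadd, hgood⟩⟩

/-- `Δ(E₀) = -116621998903287908163 = -3^6·7^3·17^3·37^7` on the integer equation of `39627j1`. [cite: Cremona2006, Table 1 (Cremona label 39627j1)] -/
theorem Δ_eq_39627j1 : (⟨0, 0, 1, -1311777, -777409819⟩ : WeierstrassCurve ℤ).Δ = -116621998903287908163 := by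
  norm_num [WeierstrassCurve.Δ, WeierstrassCurve.b₂, WeierstrassCurve.b₄, WeierstrassCurve.b₆, WeierstrassCurve.b₈]

/-- `c₄(E₀) = 62965296` on the integer equation of `39627j1`. [cite: Cremona2006, Table 1 (Cremona label 39627j1)] -/
theorem c₄_eq_39627j1 : (⟨0, 0, 1, -1311777, -777409819⟩ : WeierstrassCurve ℤ).c₄ = 62965296 := by
  norm_num [WeierstrassCurve.c₄, WeierstrassCurve.b₂, WeierstrassCurve.b₄]

/-- The Kraus list of `39627j1` consists of primes and multiplies to `|Δ(E₀)|`, IN THE KERNEL: a prime dividing `Δ_min` is one of `[3, 7, 17, 37]`. [cite: Cremona2006, Table 1 (Cremona label 39627j1)] -/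
theorem krausList_39627j1 : (∀ qe ∈ ([(3, 6), (7, 3), (17, 3), (37, 7)] : List (ℕ × ℕ)), qe.1.Prime) ∧
    (([(3, 6), (7, 3), (17, 3), (37, 7)] : List (ℕ × ℕ)).map fun qe => qe.1 ^ qe.2).prod = (-116621998903287908163 : ℤ).natAbs :=
  ⟨by decide +kernel, by decide +kernel⟩

/-- **U₀ AT `39627j1` BY THE INERT-CARRIER (Shimura-curve) ROAD, TU₀|inert** — `MissingUpperBoundAt W 3` at `W = E` (`r_an = 0`) from rhp-p2 g10's certificate shape
p662479 `leafRankZeroUpper_three_of_shimuraInertDatum_of_twistUnitZero` (Papikian–Rabinoff (DEG) at the odd carrier) through the §0 door `leafRankOneUpper_three_of_twoCarriers_of_sqrtField` of part one.  PRINTED: `hGZK hmod hnf hJL hCO hHK`.  KERNEL: `Addv ∧ SubGss` at `3`;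
`7`, `17` split (nodal roots `1`, `1`); every prime of `Δ_min` enumerated (`krausList_39627j1`) for `hothers` and `hshape` (`c = 1` off `Δ_min`, Kodaira–Néron at the
multiplicative primes, Tate certificates at the additive primes `[3]`); the congruences making `7`, `17` inert and the other `ℓ ∣ N` split in `ℚ(√-11)`; the twist
identity `Cd • E^{(-11)} = Wd`, `Cd = [1, 0, 0, 1/2]`, with `Wd` Kraus-minimal.  DISPLAYED: `hN`, `hr` (`r_an = 0`), `Dt`/`hc` (`3 ∤ c(Dt)`), `hLt0`/`hLt1` (`L(E^{(-11)},1) = 0 ≠ L′(E^{(-11)},1)`; census: root number `−1`, `L′(Wd,1) ≈ 0.757141`),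
`hqd`/`hvd` (`#Ш(Wd)_an = 1`; census: `X = L′·T²/(Ω·∏c·ĥ(P)) = 1` to `1.1e-16` at the eclib-full-saturated point `P` of height `7.197945` found by `ellrank(effort=0)`).
NO ¬CM / S2 / Σ / L₀ / L₁.  Per curve; U₀ (26024) stays OPEN class-wide; BSD is NOT proved by this.
[cite: JetchevSkinnerWan2017, §7.4.2 (p. 31)] [cite: PastenShimura2024, Prop. 6.13, Lemma 6.18] [cite: SilvermanAEC2009, VII.5 Prop. 5.1] [cite: Cremona2006, Table 1 (Cremona label 39627j1)] -/
theorem u0_at_39627j1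
    (hGZK : rank_eq_analyticRank_of_analyticRank_le_one) (hmod : hasEntireLFunction_rat)
    (hnf : exists_isNewformOf) (hJL : nonempty_shimuraParametrizationData)
    (hCO : PastenShimura2024_componentOrders)
    (hHK : shimuraCurve_heegnerPoint_grossZagier_kolyvagin)
    {W : WeierstrassCurve ℚ} [W.IsElliptic] [W.IsGloballyMinimal] (hWeq : W = (⟨0, 0, 1, -1311777, -777409819⟩ : WeierstrassCurve ℚ))
    (hN : W.conductorNorm ℤ = 39627) [NeZero (W.conductorNorm ℤ)] (hr : W.analyticRank = 0)
    (Dt : ModularParametrizationData W (W.conductorNorm ℤ)) (hc : ¬ (3 : ℤ) ∣ Dt.c)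
    (hLt0 : (W.quadraticTwist (((-11 : ℤ) : ℚ))).entireLFunction 1 = 0)
    (hLt1 : deriv (W.quadraticTwist (((-11 : ℤ) : ℚ))).entireLFunction 1 ≠ 0)
    {qd : ℚ} (hqd : haveI := isElliptic_sWd39627j1; shaAn (⟨0, 0, 1, -158725017, 1034732468756⟩ : WeierstrassCurve ℚ) = (qd : ℂ))
    (hvd : padicValRat 3 qd ≤ 0) :
    MissingUpperBoundAt W 3 := by
  subst hWeq
  haveI := isElliptic_sWd39627j1; haveI := isGloballyMinimal_sWd39627j1
  have hI : integralModelInt (⟨0, 0, 1, -1311777, -777409819⟩ : WeierstrassCurve ℚ) = (⟨0, 0, 1, -1311777, -777409819⟩ : WeierstrassCurve ℤ) :=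
    integralModelInt_eq_of_map_eq _ (map_mk_int 0 0 1 (-1311777) (-777409819))
  have hGS := subGss_three_39627j1 (W := (⟨0, 0, 1, -1311777, -777409819⟩ : WeierstrassCurve ℚ)) rfl
  have hs₁ : haveI : Fact (Nat.Prime 7) := ⟨by norm_num⟩; (⟨0, 0, 1, -1311777, -777409819⟩ : WeierstrassCurve ℚ).HasSplitMultiplicativeReductionAtPrime 7 := by
    refine IntModel.hasSplitMultiplicativeReductionAtPrime_of_intModel_of_root (hp := ⟨by norm_num⟩) hI 7 (by rw [Δ_eq_39627j1]; norm_num) (by rw [c₄_eq_39627j1]; norm_num) ⟨1, ?_⟩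
    simp only [WeierstrassCurve.c₄, WeierstrassCurve.b₂, WeierstrassCurve.b₄, WeierstrassCurve.b₆]; push_cast; decide
  have hs₂ : haveI : Fact (Nat.Prime 17) := ⟨by norm_num⟩; (⟨0, 0, 1, -1311777, -777409819⟩ : WeierstrassCurve ℚ).HasSplitMultiplicativeReductionAtPrime 17 := by
    refine IntModel.hasSplitMultiplicativeReductionAtPrime_of_intModel_of_root (hp := ⟨by norm_num⟩) hI 17 (by rw [Δ_eq_39627j1]; norm_num) (by rw [c₄_eq_39627j1]; norm_num) ⟨1, ?_⟩
    simp only [WeierstrassCurve.c₄, WeierstrassCurve.b₂, WeierstrassCurve.b₄, WeierstrassCurve.b₆]; push_cast; decide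
  haveI : Fact ((-11 : ℤ) < 0) := ⟨by norm_num⟩; haveI : Fact (Nat.Prime 7) := ⟨by norm_num⟩; haveI : Fact (Nat.Prime 17) := ⟨by norm_num⟩
  have hothers : ∀ (ℓ : ℕ) [Fact ℓ.Prime], ℓ ≠ 7 → ℓ ≠ 17 → (⟨0, 0, 1, -1311777, -777409819⟩ : WeierstrassCurve ℚ).HasSplitMultiplicativeReductionAtPrime ℓ →
      ¬ 3 ∣ padicValInt ℓ (⟨0, 0, 1, -1311777, -777409819⟩ : WeierstrassCurve ℚ).minimalDiscriminantInt := by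
    intro ℓ hℓF hne₁ hne₂ hs
    have hd := dvd_minimalDiscriminantInt_of_mult _ ℓ hs.hasMultiplicativeReductionAtPrime
    rw [IntModel.minimalDiscriminantInt_eq hI, Δ_eq_39627j1] at hd
    have hmem := mem_of_prime_dvd_of_prodPow_eq _ krausList_39627j1 hℓF.out hd
    simp only [List.map_cons, List.map_nil, List.mem_cons, List.not_mem_nil, or_false] at hmem
    rcases hmem with rfl | rfl | rfl | rfl
    · exact absurd hs.hasMultiplicativeReductionAtPrime (X9.PrintCert.not_hasMultiplicativeReductionAtPrime_of_dvd_of_dvd hI 3 (by rw [Δ_eq_39627j1]; norm_num) (by rw [c₄_eq_39627j1]; norm_num))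
    · exact absurd rfl hne₁
    · exact absurd rfl hne₂
    · rw [IntModel.minimalDiscriminantInt_eq hI, Δ_eq_39627j1, IntModel.padicValInt_eq_of_dvd_of_not_dvd 37 (e := 7) (by norm_num) (by norm_num)]
      decide
  have hshape : ∀ (q : ℕ) [Fact q.Prime], 3 ∣ ((⟨0, 0, 1, -1311777, -777409819⟩ : WeierstrassCurve ℚ).baseChange ℚ_[q]).localTamagawaNumber ℤ_[q] →
      (⟨0, 0, 1, -1311777, -777409819⟩ : WeierstrassCurve ℚ).HasSplitMultiplicativeReductionAtPrime q := by
    intro q hqF h3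
    by_cases hd : (q : ℤ) ∣ minimalDiscriminantInt (⟨0, 0, 1, -1311777, -777409819⟩ : WeierstrassCurve ℚ)
    swap
    · exact absurd h3 (not_three_dvd_localTamagawaNumber_of_not_dvd _ q hd)
    rw [IntModel.minimalDiscriminantInt_eq hI, Δ_eq_39627j1] at hd
    have hmem := mem_of_prime_dvd_of_prodPow_eq _ krausList_39627j1 hqF.out hd
    simp only [List.map_cons, List.map_nil, List.mem_cons, List.not_mem_nil, or_false] at hmem
    rcases hmem with rfl | rfl | rfl | rfl
    · have hc3 : ((⟨0, 0, 1, -1311777, -777409819⟩ : WeierstrassCurve ℚ).baseChange ℚ_[3]).localTamagawaNumber ℤ_[3] = 1 := -- additive `3` (I0*): Tate certificate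
        (IntModelTam.localTamagawaNumber_padic_eq_of_intModel_of_tamZ hI 3 (F := ⟨3, 9, 0, 0, 4, 6, 0, 0⟩) rfl (by decide +kernel)).trans (by decide)
      rw [hc3] at h3; exact absurd h3 (by decide)
    · exact hs₁
    · exact hs₂
    · exact (Koly.split_and_three_dvd_of_mult_of_three_dvd_localTamagawaNumber _ 37 (IntModel.hasMultiplicativeReductionAtPrime_of_intModel hI 37 (by rw [Δ_eq_39627j1]; norm_num) (by rw [c₄_eq_39627j1]; norm_num)) h3).1
  have hjac : ∀ ℓ : ℕ, ℓ.Prime → ℓ ∣ (⟨0, 0, 1, -1311777, -777409819⟩ : WeierstrassCurve ℚ).conductorNorm ℤ → ℓ ≠ 7 → ℓ ≠ 17 → ℓ ≠ 2 →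
      jacobiSym (-11) ℓ = 1 := by
    intro ℓ hℓ hℓN hne₁ hne₂ hℓ2
    rw [hN] at hℓN
    have hmem : ℓ ∈ Nat.primeFactors 39627 := Nat.mem_primeFactors.mpr ⟨hℓ, hℓN, by norm_num⟩
    rw [show Nat.primeFactors 39627 = {3, 7, 17, 37} by decide +kernel] at hmem
    simp only [Finset.mem_insert, Finset.mem_singleton] at hmem
    rcases hmem with rfl | rfl | rfl | rfl
    · norm_num [jacobiSym.mod_left]
    · exact absurd rfl hne₁
    · exact absurd rfl hne₂
    · norm_num [jacobiSym.mod_left]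
  have hWd : (⟨1, (0 : ℚ), (0 : ℚ), ((1:ℚ)/2)⟩ : VariableChange ℚ) • (⟨0, 0, 1, -1311777, -777409819⟩ : WeierstrassCurve ℚ).quadraticTwist (((-11 : ℤ) : ℚ)) =
      (⟨0, 0, 1, -158725017, 1034732468756⟩ : WeierstrassCurve ℚ) := by
    push_cast; ext <;> simp [WeierstrassCurve.variableChange_a₁, WeierstrassCurve.variableChange_a₂,
      WeierstrassCurve.variableChange_a₃, WeierstrassCurve.variableChange_a₄, WeierstrassCurve.variableChange_a₆,
      WeierstrassCurve.quadraticTwist, WeierstrassCurve.b₂, WeierstrassCurve.b₄, WeierstrassCurve.b₆] <;> norm_num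
  exact leafRankZeroUpper_three_of_twoCarriers_of_sqrtField hGZK hmod hnf hJL hCO hHK _ hGS.1 hGS.2 hr rfl Dt hc
    (q₁ := 7) (q₂ := 17) (by decide) hs₁ hs₂ hothers hshape (by decide) (by decide)
    (-11) (by norm_num)
    (by rw [show (-11 : ℤ).natAbs = 11 by rfl, Nat.squarefree_iff_nodup_primeFactorsList (by norm_num)]; simp)
    (Or.inr ⟨by decide, by norm_num [jacobiSym.mod_left]⟩) (by norm_num) (by norm_num [jacobiSym.mod_left]) (by norm_num) hjac
    (fun h _ ↦ by rw [hN] at h; norm_num at h) hLt0 hLt1 _ _ hWd hqd hvd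

/-! ## §2 `95571h1` = `[0, 0, 1, 2097, -10483]`, `N = 95571 = 3^2·7·37·41` (`3`: I₀*, `c = 1`, `7`: I3, `c = 3`, split, `37`: I1, `c = 1`, non-split, `41`: I3, `c = 3`, split); carriers `S = {7, 41}` (split, `3 ∣ ord Δ`), (DEG) by Papikian–Rabinoff at `q₂ = 41` (odd, `≡ 2 (mod 3)`);
`r_an = 0`, `#E(ℚ)_tors = 1`, `∏ c_ℓ = 9`, `#Ш(E)_an = 1` (Cremona/LMFDB, displayed where used); class `95571h` of size 1.
`V = E^{(-3)}_min = [0, 0, 1, 233, 388]` (`#Ṽ(𝔽₃) = 1`).  JSW field `K = ℚ(√-11)` (`11` prime; `7`, `41` inert, every other `ℓ ∣ N` split): the least such `D` (among those tried) with a CERTIFIED twist unit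
(kit j318499: root no. `−1`, `L′(Wd,1) = 2.469743`, `Wd = E^{(-11)}_min = [0, 0, 1, 253737, 13952540]`, `N(Wd) = 11564091`, `∏c = 2`, `T = 1`, point by `ellrank(effort=0)`, eclib-full saturation (index 1), `ĥ = 7.249254`,
`X = L′T²/(Ω∏c ĥ) = 1` to `2e-16` — the numerical `#Ш(Wd)_an` given rank `1`). -/

/-- `V = [0, 0, 1, 233, 388]` (the minimal model of `95571h1^{(-3)}`, conductor `10619`): `Δ ≠ 0` in the kernel. [cite: Cremona2006, Table 1 (Cremona label 95571h1)] -/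
theorem isElliptic_sV95571h1 : (⟨0, 0, 1, 233, 388⟩ : WeierstrassCurve ℚ).IsElliptic :=
  isElliptic_of_discOf_ne_zero 0 0 1 233 388 (by decide +kernel)

/-- `V` is globally minimal: `|Δ| = 7^3·37·41^3` kernel-checked, Kraus' criterion prime by prime. [cite: Kraus1989, Prop. 1 and Prop. 2]
[cite: SilvermanAEC2009, VII.1 Remark 1.1] [cite: Cremona2006, Table 1 (Cremona label 95571h1)] -/
theorem isGloballyMinimal_sV95571h1 : (⟨0, 0, 1, 233, 388⟩ : WeierstrassCurve ℚ).IsGloballyMinimal :=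
  isGloballyMinimal_of_krausCriterion₃_factored 0 0 1 233 388
    [(7, 3), (37, 1), (41, 3)] (by decide +kernel)
    (by intro qe hqe; simp only [List.mem_cons, List.not_mem_nil, or_false] at hqe
        rcases hqe with rfl | rfl | rfl <;> norm_num)
    (by set_option synthInstance.maxSize 2000 in decide +kernel)

/-- `Wd = [0, 0, 1, 253737, 13952540]` (the minimal model of the twist `95571h1^{(-11)}`, conductor `11564091`): `Δ ≠ 0` in the kernel. [cite: Cremona2006, Table 1 (Cremona label 95571h1)] -/
theorem isElliptic_sWd95571h1 : (⟨0, 0, 1, 253737, 13952540⟩ : WeierstrassCurve ℚ).IsElliptic :=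
  isElliptic_of_discOf_ne_zero 0 0 1 253737 13952540 (by decide +kernel)

/-- `Wd` is globally minimal: `|Δ| = 3^6·7^3·11^6·37·41^3` kernel-checked, Kraus' criterion prime by prime. [cite: Kraus1989, Prop. 1 and Prop. 2]
[cite: SilvermanAEC2009, VII.1 Remark 1.1] [cite: Cremona2006, Table 1 (Cremona label 95571h1)] -/
theorem isGloballyMinimal_sWd95571h1 : (⟨0, 0, 1, 253737, 13952540⟩ : WeierstrassCurve ℚ).IsGloballyMinimal :=
  isGloballyMinimal_of_krausCriterion₃_factored 0 0 1 253737 13952540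
    [(3, 6), (7, 3), (11, 6), (37, 1), (41, 3)] (by decide +kernel)
    (by intro qe hqe; simp only [List.mem_cons, List.not_mem_nil, or_false] at hqe
        rcases hqe with rfl | rfl | rfl | rfl | rfl <;> norm_num)
    (by set_option synthInstance.maxSize 2000 in decide +kernel)

/-- **`95571h1` is ADDITIVE at `3` and on the cell (G) ∧ ss, IN THE KERNEL**: `3 ∣ Δ`, `3 ∣ c₄`; `C • V^{(-3)} = E` (`[u, r, s, t] = [1, 0, 0, 1/2]`) with
`V` globally minimal, `3 ∤ Δ(V)`, `#Ṽ(𝔽₃) = 1` (`a₃(V) = 3`, supersingular), whence `TypeG`, `SubGord`, `SubGss` at `3` (g13's block, unchanged).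
[cite: SilvermanAEC2009, VII.5 Prop. 5.1 (a), (c)] [cite: Delbourgo1998, §1.5 (G)] [cite: Cremona2006, Table 1 (Cremona label 95571h1)] -/
theorem subGss_three_95571h1 {W : WeierstrassCurve ℚ} [W.IsElliptic] [W.IsGloballyMinimal] (hWeq : W = (⟨0, 0, 1, 2097, -10483⟩ : WeierstrassCurve ℚ)) :
    Addv W 3 ∧ SubGss W 3 := by
  subst hWeq
  haveI := isElliptic_sV95571h1
  haveI := isGloballyMinimal_sV95571h1
  have hIW : integralModelInt (⟨0, 0, 1, 2097, -10483⟩ : WeierstrassCurve ℚ) = (⟨0, 0, 1, 2097, -10483⟩ : WeierstrassCurve ℤ) :=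
    integralModelInt_eq_of_map_eq _ (map_mk_int 0 0 1 2097 (-10483))
  have hadd : Addv (⟨0, 0, 1, 2097, -10483⟩ : WeierstrassCurve ℚ) 3 := Additive.addv_of_intModel hIW 3 (by decide +kernel) (by decide +kernel)
  have hIV : integralModelInt (⟨0, 0, 1, 233, 388⟩ : WeierstrassCurve ℚ) = (⟨0, 0, 1, 233, 388⟩ : WeierstrassCurve ℤ) :=
    integralModelInt_eq_of_map_eq _ (map_mk_int 0 0 1 233 388)
  have hcV : Nat.card ((((⟨0, 0, 1, 233, 388⟩ : WeierstrassCurve ℤ)).map (Int.castRingHom (ZMod 3))).toAffine.Point) = 1 := by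
    have h := natCard_point_eq_countPoints 0 0 1 233 388 3 (by norm_num) (by decide +kernel)
    have h' : countPoints [0, 0, 1, 233, 388] 3 = 1 := countPoints_eq_of_fast (by decide +kernel)
    exact_mod_cast h.trans h'
  have hgood : GoodSS (⟨0, 0, 1, 233, 388⟩ : WeierstrassCurve ℚ) 3 := Supersingular.goodSS_of_intModel 3 hIV (by decide +kernel) hcV (by decide)
  have hVW : (⟨1, (0 : ℚ), (0 : ℚ), ((1:ℚ)/2)⟩ : VariableChange ℚ) • (⟨0, 0, 1, 233, 388⟩ : WeierstrassCurve ℚ).quadraticTwist (-3) =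
      (⟨0, 0, 1, 2097, -10483⟩ : WeierstrassCurve ℚ) := by
    ext <;> simp [WeierstrassCurve.variableChange_a₁, WeierstrassCurve.variableChange_a₂,
      WeierstrassCurve.variableChange_a₃, WeierstrassCurve.variableChange_a₄, WeierstrassCurve.variableChange_a₆,
      WeierstrassCurve.quadraticTwist, WeierstrassCurve.b₂, WeierstrassCurve.b₄, WeierstrassCurve.b₆] <;> norm_num
  obtain ⟨C, hC⟩ := exists_variableChange_quadraticTwist_symm (⟨0, 0, 1, 2097, -10483⟩ : WeierstrassCurve ℚ)
    (⟨0, 0, 1, 233, 388⟩ : WeierstrassCurve ℚ) (d := (-3 : ℚ)) (by norm_num) ⟨_, hVW⟩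
  have hC' : C • (⟨0, 0, 1, 2097, -10483⟩ : WeierstrassCurve ℚ).quadraticTwist ((-1 : ℚ) ^ ((3 : ℕ) / 2) * (3 : ℕ)) =
      (⟨0, 0, 1, 233, 388⟩ : WeierstrassCurve ℚ) := by
    rw [O5.pstar_three]; exact hC
  have hG : TypeG (⟨0, 0, 1, 2097, -10483⟩ : WeierstrassCurve ℚ) 3 := (typeG_three_iff_good_twist _ hadd _ C hC').mpr hgood.1
  exact ⟨hadd, (O5.subGss_three_iff_subGord_and_goodSS_twist _ hadd _ C hC).mpr
    ⟨subGord_three_of_typeG_of_addv _ hG hadd, hgood⟩⟩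

/-- `Δ(E₀) = -637639103619 = -3^6·7^3·37·41^3` on the integer equation of `95571h1`. [cite: Cremona2006, Table 1 (Cremona label 95571h1)] -/
theorem Δ_eq_95571h1 : (⟨0, 0, 1, 2097, -10483⟩ : WeierstrassCurve ℤ).Δ = -637639103619 := by
  norm_num [WeierstrassCurve.Δ, WeierstrassCurve.b₂, WeierstrassCurve.b₄, WeierstrassCurve.b₆, WeierstrassCurve.b₈]

/-- `c₄(E₀) = -100656` on the integer equation of `95571h1`. [cite: Cremona2006, Table 1 (Cremona label 95571h1)] -/
theorem c₄_eq_95571h1 : (⟨0, 0, 1, 2097, -10483⟩ : WeierstrassCurve ℤ).c₄ = -100656 := by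
  norm_num [WeierstrassCurve.c₄, WeierstrassCurve.b₂, WeierstrassCurve.b₄]

/-- The Kraus list of `95571h1` consists of primes and multiplies to `|Δ(E₀)|`, IN THE KERNEL: a prime dividing `Δ_min` is one of `[3, 7, 37, 41]`. [cite: Cremona2006, Table 1 (Cremona label 95571h1)] -/
theorem krausList_95571h1 : (∀ qe ∈ ([(3, 6), (7, 3), (37, 1), (41, 3)] : List (ℕ × ℕ)), qe.1.Prime) ∧
    (([(3, 6), (7, 3), (37, 1), (41, 3)] : List (ℕ × ℕ)).map fun qe => qe.1 ^ qe.2).prod = (-637639103619 : ℤ).natAbs :=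
  ⟨by decide +kernel, by decide +kernel⟩

/-- **U₀ AT `95571h1` BY THE INERT-CARRIER (Shimura-curve) ROAD, TU₀|inert** — `MissingUpperBoundAt W 3` at `W = E` (`r_an = 0`) from rhp-p2 g10's certificate shape
p662479 `leafRankZeroUpper_three_of_shimuraInertDatum_of_twistUnitZero` (Papikian–Rabinoff (DEG) at the odd carrier) through the §0 door `leafRankOneUpper_three_of_twoCarriers_of_sqrtField` of part one.  PRINTED: `hGZK hmod hnf hJL hCO hHK`.  KERNEL: `Addv ∧ SubGss` at `3`;
`7`, `41` split (nodal roots `2`, `7`); every prime of `Δ_min` enumerated (`krausList_95571h1`) for `hothers` and `hshape` (`c = 1` off `Δ_min`, Kodaira–Néron at the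
multiplicative primes, Tate certificates at the additive primes `[3]`); the congruences making `7`, `41` inert and the other `ℓ ∣ N` split in `ℚ(√-11)`; the twist
identity `Cd • E^{(-11)} = Wd`, `Cd = [1, 0, 0, 1/2]`, with `Wd` Kraus-minimal.  DISPLAYED: `hN`, `hr` (`r_an = 0`), `Dt`/`hc` (`3 ∤ c(Dt)`), `hLt0`/`hLt1` (`L(E^{(-11)},1) = 0 ≠ L′(E^{(-11)},1)`; census: root number `−1`, `L′(Wd,1) ≈ 2.469743`),
`hqd`/`hvd` (`#Ш(Wd)_an = 1`; census: `X = L′·T²/(Ω·∏c·ĥ(P)) = 1` to `2.2e-16` at the eclib-full-saturated point `P` of height `7.249254` found by `ellrank(effort=0)`).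
NO ¬CM / S2 / Σ / L₀ / L₁.  Per curve; U₀ (26024) stays OPEN class-wide; BSD is NOT proved by this.
[cite: JetchevSkinnerWan2017, §7.4.2 (p. 31)] [cite: PastenShimura2024, Prop. 6.13, Lemma 6.18] [cite: SilvermanAEC2009, VII.5 Prop. 5.1] [cite: Cremona2006, Table 1 (Cremona label 95571h1)] -/
theorem u0_at_95571h1
    (hGZK : rank_eq_analyticRank_of_analyticRank_le_one) (hmod : hasEntireLFunction_rat)
    (hnf : exists_isNewformOf) (hJL : nonempty_shimuraParametrizationData)
    (hCO : PastenShimura2024_componentOrders)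
    (hHK : shimuraCurve_heegnerPoint_grossZagier_kolyvagin)
    {W : WeierstrassCurve ℚ} [W.IsElliptic] [W.IsGloballyMinimal] (hWeq : W = (⟨0, 0, 1, 2097, -10483⟩ : WeierstrassCurve ℚ))
    (hN : W.conductorNorm ℤ = 95571) [NeZero (W.conductorNorm ℤ)] (hr : W.analyticRank = 0)
    (Dt : ModularParametrizationData W (W.conductorNorm ℤ)) (hc : ¬ (3 : ℤ) ∣ Dt.c)
    (hLt0 : (W.quadraticTwist (((-11 : ℤ) : ℚ))).entireLFunction 1 = 0)
    (hLt1 : deriv (W.quadraticTwist (((-11 : ℤ) : ℚ))).entireLFunction 1 ≠ 0)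
    {qd : ℚ} (hqd : haveI := isElliptic_sWd95571h1; shaAn (⟨0, 0, 1, 253737, 13952540⟩ : WeierstrassCurve ℚ) = (qd : ℂ))
    (hvd : padicValRat 3 qd ≤ 0) :
    MissingUpperBoundAt W 3 := by
  subst hWeq
  haveI := isElliptic_sWd95571h1; haveI := isGloballyMinimal_sWd95571h1
  have hI : integralModelInt (⟨0, 0, 1, 2097, -10483⟩ : WeierstrassCurve ℚ) = (⟨0, 0, 1, 2097, -10483⟩ : WeierstrassCurve ℤ) :=
    integralModelInt_eq_of_map_eq _ (map_mk_int 0 0 1 2097 (-10483))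
  have hGS := subGss_three_95571h1 (W := (⟨0, 0, 1, 2097, -10483⟩ : WeierstrassCurve ℚ)) rfl
  have hs₁ : haveI : Fact (Nat.Prime 7) := ⟨by norm_num⟩; (⟨0, 0, 1, 2097, -10483⟩ : WeierstrassCurve ℚ).HasSplitMultiplicativeReductionAtPrime 7 := by
    refine IntModel.hasSplitMultiplicativeReductionAtPrime_of_intModel_of_root (hp := ⟨by norm_num⟩) hI 7 (by rw [Δ_eq_95571h1]; norm_num) (by rw [c₄_eq_95571h1]; norm_num) ⟨2, ?_⟩
    simp only [WeierstrassCurve.c₄, WeierstrassCurve.b₂, WeierstrassCurve.b₄, WeierstrassCurve.b₆]; push_cast; decide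
  have hs₂ : haveI : Fact (Nat.Prime 41) := ⟨by norm_num⟩; (⟨0, 0, 1, 2097, -10483⟩ : WeierstrassCurve ℚ).HasSplitMultiplicativeReductionAtPrime 41 := by
    refine IntModel.hasSplitMultiplicativeReductionAtPrime_of_intModel_of_root (hp := ⟨by norm_num⟩) hI 41 (by rw [Δ_eq_95571h1]; norm_num) (by rw [c₄_eq_95571h1]; norm_num) ⟨7, ?_⟩
    simp only [WeierstrassCurve.c₄, WeierstrassCurve.b₂, WeierstrassCurve.b₄, WeierstrassCurve.b₆]; push_cast; decide
  haveI : Fact ((-11 : ℤ) < 0) := ⟨by norm_num⟩; haveI : Fact (Nat.Prime 7) := ⟨by norm_num⟩; haveI : Fact (Nat.Prime 41) := ⟨by norm_num⟩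
  have hothers : ∀ (ℓ : ℕ) [Fact ℓ.Prime], ℓ ≠ 7 → ℓ ≠ 41 → (⟨0, 0, 1, 2097, -10483⟩ : WeierstrassCurve ℚ).HasSplitMultiplicativeReductionAtPrime ℓ →
      ¬ 3 ∣ padicValInt ℓ (⟨0, 0, 1, 2097, -10483⟩ : WeierstrassCurve ℚ).minimalDiscriminantInt := by
    intro ℓ hℓF hne₁ hne₂ hs
    have hd := dvd_minimalDiscriminantInt_of_mult _ ℓ hs.hasMultiplicativeReductionAtPrime
    rw [IntModel.minimalDiscriminantInt_eq hI, Δ_eq_95571h1] at hd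
    have hmem := mem_of_prime_dvd_of_prodPow_eq _ krausList_95571h1 hℓF.out hd
    simp only [List.map_cons, List.map_nil, List.mem_cons, List.not_mem_nil, or_false] at hmem
    rcases hmem with rfl | rfl | rfl | rfl
    · exact absurd hs.hasMultiplicativeReductionAtPrime (X9.PrintCert.not_hasMultiplicativeReductionAtPrime_of_dvd_of_dvd hI 3 (by rw [Δ_eq_95571h1]; norm_num) (by rw [c₄_eq_95571h1]; norm_num))
    · exact absurd rfl hne₁
    · rw [IntModel.minimalDiscriminantInt_eq hI, Δ_eq_95571h1, IntModel.padicValInt_eq_of_dvd_of_not_dvd 37 (e := 1) (by norm_num) (by norm_num)]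
      decide
    · exact absurd rfl hne₂
  have hshape : ∀ (q : ℕ) [Fact q.Prime], 3 ∣ ((⟨0, 0, 1, 2097, -10483⟩ : WeierstrassCurve ℚ).baseChange ℚ_[q]).localTamagawaNumber ℤ_[q] →
      (⟨0, 0, 1, 2097, -10483⟩ : WeierstrassCurve ℚ).HasSplitMultiplicativeReductionAtPrime q := by
    intro q hqF h3
    by_cases hd : (q : ℤ) ∣ minimalDiscriminantInt (⟨0, 0, 1, 2097, -10483⟩ : WeierstrassCurve ℚ)
    swap
    · exact absurd h3 (not_three_dvd_localTamagawaNumber_of_not_dvd _ q hd)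
    rw [IntModel.minimalDiscriminantInt_eq hI, Δ_eq_95571h1] at hd
    have hmem := mem_of_prime_dvd_of_prodPow_eq _ krausList_95571h1 hqF.out hd
    simp only [List.map_cons, List.map_nil, List.mem_cons, List.not_mem_nil, or_false] at hmem
    rcases hmem with rfl | rfl | rfl | rfl
    · have hc3 : ((⟨0, 0, 1, 2097, -10483⟩ : WeierstrassCurve ℚ).baseChange ℚ_[3]).localTamagawaNumber ℤ_[3] = 1 := -- additive `3` (I0*): Tate certificate
        (IntModelTam.localTamagawaNumber_padic_eq_of_intModel_of_tamZ hI 3 (F := ⟨3, 9, 0, 0, 4, 6, 0, 0⟩) rfl (by decide +kernel)).trans (by decide)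
      rw [hc3] at h3; exact absurd h3 (by decide)
    · exact hs₁
    · exact (Koly.split_and_three_dvd_of_mult_of_three_dvd_localTamagawaNumber _ 37 (IntModel.hasMultiplicativeReductionAtPrime_of_intModel hI 37 (by rw [Δ_eq_95571h1]; norm_num) (by rw [c₄_eq_95571h1]; norm_num)) h3).1
    · exact hs₂
  have hjac : ∀ ℓ : ℕ, ℓ.Prime → ℓ ∣ (⟨0, 0, 1, 2097, -10483⟩ : WeierstrassCurve ℚ).conductorNorm ℤ → ℓ ≠ 7 → ℓ ≠ 41 → ℓ ≠ 2 →
      jacobiSym (-11) ℓ = 1 := by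
    intro ℓ hℓ hℓN hne₁ hne₂ hℓ2
    rw [hN] at hℓN
    have hmem : ℓ ∈ Nat.primeFactors 95571 := Nat.mem_primeFactors.mpr ⟨hℓ, hℓN, by norm_num⟩
    rw [show Nat.primeFactors 95571 = {3, 7, 37, 41} by decide +kernel] at hmem
    simp only [Finset.mem_insert, Finset.mem_singleton] at hmem
    rcases hmem with rfl | rfl | rfl | rfl
    · norm_num [jacobiSym.mod_left]
    · exact absurd rfl hne₁
    · norm_num [jacobiSym.mod_left]
    · exact absurd rfl hne₂
  have hWd : (⟨1, (0 : ℚ), (0 : ℚ), ((1:ℚ)/2)⟩ : VariableChange ℚ) • (⟨0, 0, 1, 2097, -10483⟩ : WeierstrassCurve ℚ).quadraticTwist (((-11 : ℤ) : ℚ)) =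
      (⟨0, 0, 1, 253737, 13952540⟩ : WeierstrassCurve ℚ) := by
    push_cast; ext <;> simp [WeierstrassCurve.variableChange_a₁, WeierstrassCurve.variableChange_a₂,
      WeierstrassCurve.variableChange_a₃, WeierstrassCurve.variableChange_a₄, WeierstrassCurve.variableChange_a₆,
      WeierstrassCurve.quadraticTwist, WeierstrassCurve.b₂, WeierstrassCurve.b₄, WeierstrassCurve.b₆] <;> norm_num
  exact leafRankZeroUpper_three_of_twoCarriers_of_sqrtField hGZK hmod hnf hJL hCO hHK _ hGS.1 hGS.2 hr rfl Dt hc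
    (q₁ := 7) (q₂ := 41) (by decide) hs₁ hs₂ hothers hshape (by decide) (by decide)
    (-11) (by norm_num)
    (by rw [show (-11 : ℤ).natAbs = 11 by rfl, Nat.squarefree_iff_nodup_primeFactorsList (by norm_num)]; simp)
    (Or.inr ⟨by decide, by norm_num [jacobiSym.mod_left]⟩) (by norm_num) (by norm_num [jacobiSym.mod_left]) (by norm_num) hjac
    (fun h _ ↦ by rw [hN] at h; norm_num at h) hLt0 hLt1 _ _ hWd hqd hvd

end Summit.BirchSwinnertonDyer.BirchSwinnertonDyer.Theorems.RamifiedHeegnerPairTwistUnitInertZero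

end
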